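import Summits.BirchSwinnertonDyer.BirchSwinnertonDyer.Theorems.ThetaPartnerAtTwoMazurTateCongruenceAtTwoRSymbolMuOfCuspSpan
import Literature.NumberTheory.EllipticCurves.SkinnerUrban2014.PAdicUnitPeriodRatioAnyPrimeProofs
import HarnessLib

/-!
# Crux `MazurTateCongruenceAtTwoTop` (stmt-BirchSwinnertonDyer-25797 = `MazurTateCongruenceAtTwoR` 21416), line `symbol`:
# POINTWISE closers — the crux's conclusion at one pair `(W, A)` behind the seven named facts and, as the ONLY research input,
# either the per-curve statement (PR₂) at `W` and at `A`, or `CuspSpanEvenAtTwo` at the two conductors, or — with NO conjecture-grade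
# input — two `2`-adic UNIT L-values `[0]⁺_f`, `[0]⁺_{f_A}` (width seat bsd-wall-tp2-p1-w2 g2; `--supports stmt-BirchSwinnertonDyer-25797`)

HONEST FRAMING. THEOREMS ONLY. The named Literature facts and the research statements are explicit HYPOTHESES; nothing about their
truth is asserted; BSD is not proved by any of this.

WHAT. `…RSymbolMuOfCuspSpan` (this seat) put the crux BY NAME behind PUB⁶ + `realPeriodRat_eq_unit_mul_plusPeriod_two` + «`∀ N` odd,
`CuspSpanEvenAtTwo N`». Here the same chain is run at ONE pair, so that per-class instances can discharge the research input by
certificate: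

* §1 `symbolMu_of_undepletedMax` — `Hμ(E)` (the symbol-`μ` statement of `…RAssembly` at one curve, one `S₀`) from the period fact and
  the PER-CURVE statement (PR₂) «the undepleted `2`-adic plus symbol `[·]⁺_f` is maximal over `ℚ` at a `2`-power cusp of some even
  layer» (`μ(ϑ_{n₁}(f)) = 0` at one even layer; one finite modular-symbol computation per curve); `symbolMu_of_norm_ratPlusSymbol_zero_eq_one`
  — `Hμ(E)` from the period fact and a UNIT L-value `‖[0]⁺_f‖₂ = 1` (then (PR₂) holds at layer `0`, rtt-p3-w3 g4's
  `undepletedMax_layerZero_of_norm_ratPlusSymbol_zero_eq_one`; no conjecture-grade input).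
* §2 `mazurTateCongruence_of_facts_undepletedMax` / `…_of_facts_cuspSpanAt` / `…_of_facts_unitLValues` — the CONCLUSION OF THE CRUX at
  `(W, A)` (with `u = 1`, every even layer, every admissible `S₀`, every Pollack pair, every integral multiple) from PUB⁶ + the period
  fact + respectively {(PR₂) at `(W,f)` and at `(A,f_A)`}, {`CuspSpanEvenAtTwo N_W`, `CuspSpanEvenAtTwo N_A`}, {`‖[0]⁺_f‖₂ = 1`,
  `‖[0]⁺_{f_A}‖₂ = 1`} — via the lead's one-socket assembly `mazurTateCongruence_of_facts` (`…RAssembly`).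
* §3 `mazurTateCongruenceAtTwoTop_of_facts_undepletedMax` — THE CRUX BY NAME behind PUB⁶ + the period fact + «(PR₂) for every globally
  minimal curve good supersingular at `2` with `a₂ = 0`» (weaker than `CuspSpanEvenAtTwo` at all odd levels, which implies it:
  `undepletedMax_of_cuspSpanEvenAtTwo`).

References: [GreenbergVatsal2000] Thm. (1.4), §3 (13), Remark 3.4; [Vatsal1999] Thm. (1.13); [PollackWeston2011MT] Rem. 4.2.1, Thm. 4.1;
[Pollack2003] Conj. 6.3; [Kurihara2002] Thm. 0.1; [MazurTateTeitelbaum1986Invent] §I.4, §I.8.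
-/

-- justification: the `Summit.BirchSwinnertonDyer.BirchSwinnertonDyer.…` path repeats a component (route-file convention)
set_option linter.dupNamespace false
set_option autoImplicit false

noncomputable section

open scoped Classical MatrixGroups ModularForm

open CongruenceSubgroup Polynomial WeierstrassCurve NumberField IsDedekindDomain
  Literature.NumberTheory.IwasawaTheory Literature.NumberTheory.EllipticCurves Literature.NumberTheory.EllipticCurves.ModularForms
  Literature.NumberTheory.EllipticCurves.Rank1Residual Literature.NumberTheory.EllipticCurves.GreenbergVatsal2000
  Summit.BirchSwinnertonDyer.Rank1Residual.Supersingular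
  Summit.BirchSwinnertonDyer.BirchSwinnertonDyer.Theorems.ThetaLayerLambdaCongruenceAtTwo

namespace Summit.BirchSwinnertonDyer.BirchSwinnertonDyer.Theorems.MazurTateCongruenceAtTwoR

/-! ## §1. `Hμ(E)` from the per-curve statement (PR₂), and from a unit L-value -/

section PerCurve

variable (E : WeierstrassCurve ℚ) [E.IsElliptic] [E.IsGloballyMinimal]

/-- **`Hμ(E)` from (PR₂) at `(E, f)`.** For a globally minimal elliptic `E` good supersingular at `2` with `a₂(E) = 0`, its newform `f`,
`ϖ` with `ϖ·Ω_E = Ω⁺_f` and `S₀` off `2`: granted `realPeriodRat_eq_unit_mul_plusPeriod_two`, if the undepleted `2`-adic plus symbol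
`[·]⁺_f` is maximal over `ℚ` at a `2`-power cusp of some even layer (PR₂), then the expanded `S₀`-depleted plus table is maximal over `ℚ` at
some `x₀` with `‖2ϖΨ^{S₀}_E(x₀)‖ = 1`. (The maximum is `2`: Manin cusp `1/2` and `norm_ratPlusSymbol_le_two`; un-depletion by
`exists_depletedMax_eq_of_undepletedMax`; `‖ϖ‖₂ = 1`.) [cite: PollackWeston2011MT, Rem. 4.2.1] [cite: GreenbergVatsal2000, §3, Remark 3.4] -/
theorem symbolMu_of_undepletedMax (h2 : realPeriodRat_eq_unit_mul_plusPeriod_two) (hss : GoodSS E 2)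
    (ha : E.frobeniusTrace 2 = 0) [NeZero (E.conductorNorm ℤ)] {f : CuspForm (Gamma0 (E.conductorNorm ℤ)) 2} (hf : IsNewformOf E f)
    {ϖ : ℚ} (hϖ : (ϖ : ℝ) * E.realPeriodRat = plusPeriod f)
    (S₀ : Finset (HeightOneSpectrum (𝓞 ℚ))) (hS2 : ∀ v ∈ S₀, ((2 : ℕ) : 𝓞 ℚ) ∉ v.asIdeal)
    (hPR : ∃ n₁ : ℕ, Even n₁ ∧ ∃ s : ZMod (2 ^ n₁), ∀ r : ℚ, ‖algebraMap ℚ (PadicAlgCl 2) (ratPlusSymbol f r)‖ ≤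
      ‖algebraMap ℚ (PadicAlgCl 2) (ratPlusSymbol f ((((cyclotomicGenerator 2 : ZMod (2 ^ (n₁ + 2))) ^ s.val).val : ℚ) / (2 : ℚ) ^ (n₁ + 2)))‖) :
    ∃ x₀ : ℚ, (∀ r : ℚ, ‖(∑ k ∈ Fintype.piFinset (fun _ : S₀ ↦ Finset.range 3), (∏ v : S₀, ((E.localPolynomialAt (v : HeightOneSpectrum (𝓞 ℚ))).map (Int.castRingHom (PadicAlgCl 2))).coeff (k v) * ((Rat.HeightOneSpectrum.natGenerator (v : HeightOneSpectrum (𝓞 ℚ)) : PadicAlgCl 2)⁻¹) ^ (k v)) * algebraMap ℚ (PadicAlgCl 2) (ratPlusSymbol f (r * ((∏ v : S₀, Rat.HeightOneSpectrum.natGenerator (v : HeightOneSpectrum (𝓞 ℚ)) ^ (k v) : ℕ) : ℚ))))‖ ≤ ‖(∑ k ∈ Fintype.piFinset (fun _ : S₀ ↦ Finset.range 3), (∏ v : S₀, ((E.localPolynomialAt (v : HeightOneSpectrum (𝓞 ℚ))).map (Int.castRingHom (PadicAlgCl 2))).coeff (k v) * ((Rat.HeightOneSpectrum.natGenerator (v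 : HeightOneSpectrum (𝓞 ℚ)) : PadicAlgCl 2)⁻¹) ^ (k v)) * algebraMap ℚ (PadicAlgCl 2) (ratPlusSymbol f (x₀ * ((∏ v : S₀, Rat.HeightOneSpectrum.natGenerator (v : HeightOneSpectrum (𝓞 ℚ)) ^ (k v) : ℕ) : ℚ))))‖) ∧
      ‖algebraMap ℚ (PadicAlgCl 2) (2 * ϖ) * (∑ k ∈ Fintype.piFinset (fun _ : S₀ ↦ Finset.range 3), (∏ v : S₀, ((E.localPolynomialAt (v : HeightOneSpectrum (𝓞 ℚ))).map (Int.castRingHom (PadicAlgCl 2))).coeff (k v) * ((Rat.HeightOneSpectrum.natGenerator (v : HeightOneSpectrum (𝓞 ℚ)) : PadicAlgCl 2)⁻¹) ^ (k v)) * algebraMap ℚ (PadicAlgCl 2) (ratPlusSymbol f (x₀ * ((∏ v : S₀, Rat.HeightOneSpectrum.natGenerator (v : HeightOneSpectrum (𝓞 ℚ)) ^ (k v) : ℕ) : ℚ))))‖ = 1 := by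
  obtain ⟨n₁, hn₁, s₁, hmax⟩ := hPR
  -- the undepleted maximum is exactly `2`
  have hV : ‖algebraMap ℚ (PadicAlgCl 2) (ratPlusSymbol f ((((cyclotomicGenerator 2 : ZMod (2 ^ (n₁ + 2))) ^ s₁.val).val : ℚ) / (2 : ℚ) ^ (n₁ + 2)))‖ = 2 := by
    refine le_antisymm (norm_ratPlusSymbol_le_two hf hss ha _) ?_
    obtain ⟨γ, -, hγ⟩ := exists_ratPlusSymbol_maninCusp_eq_one_half f hf.1 hf.coeffField_eq_bot
    refine le_trans (le_of_eq ?_) (hmax ((((γ : SL(2, ℤ)) 0 0 : ℚ)) / (((γ : SL(2, ℤ)) 1 0 : ℚ))))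
    rw [hγ, one_div, map_inv₀, map_ofNat, norm_inv, ResidualThetaLayer.norm_two_padicAlgCl, inv_inv]
  -- un-depletion: the depleted maximum, of the same value `2`
  obtain ⟨n, -, s, hle, hval⟩ := exists_depletedMax_eq_of_undepletedMax E hss ha hf hn₁ hmax S₀ hS2
  rw [hV] at hval
  refine ⟨(((cyclotomicGenerator 2 : ZMod (2 ^ (n + 2))) ^ s.val).val : ℚ) / (2 : ℚ) ^ (n + 2), hle, ?_⟩
  have hϖ1 : ‖algebraMap ℚ (PadicAlgCl 2) ϖ‖ = 1 := by
    rw [norm_algebraMap_rat_eq_norm_ratCast_padic]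
    exact norm_ratCast_periodRatio_eq_one_two h2 E hss hf hϖ
  rw [norm_mul, hval, map_mul, norm_mul, hϖ1, map_ofNat, ResidualThetaLayer.norm_two_padicAlgCl]
  norm_num

/-- **`Hμ(E)` from a `2`-adic UNIT L-value — no conjecture-grade input.** For a globally minimal elliptic `E` good supersingular at `2`
with `a₂(E) = 0`, its newform `f`, `ϖ` with `ϖ·Ω_E = Ω⁺_f` and `S₀` off `2`: granted `realPeriodRat_eq_unit_mul_plusPeriod_two`, if
`[0]⁺_f = L(f,1)/Ω⁺_f` is a `2`-adic unit (equivalently, by the period fact, `L(E,1)/Ω_E ∈ ℤ₂ˣ` — Kurihara's unit-L-value case), then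
`Hμ(E)` holds: (PR₂) holds at layer `0` (`[0]⁺ = −2[1/4]⁺` from `T₂ = a₂ = 0`, rtt-p3-w3 g4's
`undepletedMax_layerZero_of_norm_ratPlusSymbol_zero_eq_one`), then §1. [cite: Kurihara2002, Thm. 0.1 (unit L-value hypothesis; shape)]
[cite: MazurTateTeitelbaum1986Invent, §I.4 (4.2)] -/
theorem symbolMu_of_norm_ratPlusSymbol_zero_eq_one (h2 : realPeriodRat_eq_unit_mul_plusPeriod_two) (hss : GoodSS E 2)
    (ha : E.frobeniusTrace 2 = 0) [NeZero (E.conductorNorm ℤ)] {f : CuspForm (Gamma0 (E.conductorNorm ℤ)) 2} (hf : IsNewformOf E f)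
    {ϖ : ℚ} (hϖ : (ϖ : ℝ) * E.realPeriodRat = plusPeriod f)
    (S₀ : Finset (HeightOneSpectrum (𝓞 ℚ))) (hS2 : ∀ v ∈ S₀, ((2 : ℕ) : 𝓞 ℚ) ∉ v.asIdeal)
    (h0 : ‖algebraMap ℚ (PadicAlgCl 2) (ratPlusSymbol f 0)‖ = 1) :
    ∃ x₀ : ℚ, (∀ r : ℚ, ‖(∑ k ∈ Fintype.piFinset (fun _ : S₀ ↦ Finset.range 3), (∏ v : S₀, ((E.localPolynomialAt (v : HeightOneSpectrum (𝓞 ℚ))).map (Int.castRingHom (PadicAlgCl 2))).coeff (k v) * ((Rat.HeightOneSpectrum.natGenerator (v : HeightOneSpectrum (𝓞 ℚ)) : PadicAlgCl 2)⁻¹) ^ (k v)) * algebraMap ℚ (PadicAlgCl 2) (ratPlusSymbol f (r * ((∏ v : S₀, Rat.HeightOneSpectrum.natGenerator (v : HeightOneSpectrum (𝓞 ℚ)) ^ (k v) : ℕ) : ℚ))))‖ ≤ ‖(∑ k ∈ Fintype.piFinset (fun _ : S₀ ↦ Finset.range 3), (∏ v : S₀, ((E.localPolynomialAt (v : HeightOneSpectrum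 (𝓞 ℚ))).map (Int.castRingHom (PadicAlgCl 2))).coeff (k v) * ((Rat.HeightOneSpectrum.natGenerator (v : HeightOneSpectrum (𝓞 ℚ)) : PadicAlgCl 2)⁻¹) ^ (k v)) * algebraMap ℚ (PadicAlgCl 2) (ratPlusSymbol f (x₀ * ((∏ v : S₀, Rat.HeightOneSpectrum.natGenerator (v : HeightOneSpectrum (𝓞 ℚ)) ^ (k v) : ℕ) : ℚ))))‖) ∧
      ‖algebraMap ℚ (PadicAlgCl 2) (2 * ϖ) * (∑ k ∈ Fintype.piFinset (fun _ : S₀ ↦ Finset.range 3), (∏ v : S₀, ((E.localPolynomialAt (v : HeightOneSpectrum (𝓞 ℚ))).map (Int.castRingHom (PadicAlgCl 2))).coeff (k v) * ((Rat.HeightOneSpectrum.natGenerator (v : HeightOneSpectrum (𝓞 ℚ)) : PadicAlgCl 2)⁻¹) ^ (k v)) * algebraMap ℚ (PadicAlgCl 2) (ratPlusSymbol f (x₀ * ((∏ v : S₀, Rat.HeightOneSpectrum.natGenerator (v : HeightOneSpectrum (𝓞 ℚ)) ^ (k v) : ℕ) : ℚ))))‖ = 1 :=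
  symbolMu_of_undepletedMax E h2 hss ha hf hϖ S₀ hS2 (undepletedMax_layerZero_of_norm_ratPlusSymbol_zero_eq_one hf hss ha h0)

end PerCurve

/-! ## §2. The conclusion of the crux at one pair `(W, A)` -/

section Pair

variable (W : WeierstrassCurve ℚ) [W.IsElliptic] [W.IsGloballyMinimal] (A : WeierstrassCurve ℚ) [A.IsElliptic]
  [A.IsGloballyMinimal]

/-- **The crux's conclusion at `(W, A)` from PUB⁶ + the period fact + (PR₂) at the two curves.** For `W, A` globally minimal, good
supersingular at `2` with `a₂ = 0`, `Δ_W < 0`, a Galois-equivariant `W[2] ≃+ A[2]`, newforms `f, f_A` with Pollack pairs at `2`, Néron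
ratios `ϖ·Ω_W = Ω⁺_f`, `ϖ_A·Ω_A = Ω⁺_{f_A}`, an admissible `S₀` (odd places ⊇ bad(W) ∪ bad(A)) and integral multiples `ι G = 2^m ϖ ι L♭`,
`ι G_A = 2^{m'} ϖ_A ι L♭_A`: granted the six plus-line facts, `realPeriodRat_eq_unit_mul_plusPeriod_two`, and (PR₂) at `(W, f)` and at
`(A, f_A)` (each: the undepleted `2`-adic plus symbol is maximal over `ℚ` at a `2`-power cusp of some even layer — `μ(ϑ_n) = 0` at one
even layer, one finite computation per curve), the oriented `S₀`-depleted Mazur–Tate congruence holds at every even layer with `u = 1`.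
[cite: GreenbergVatsal2000, Thm. (1.4), §3 (13)] [cite: Vatsal1999, Thm. (1.13)] [cite: PollackWeston2011MT, Rem. 4.2.1] -/
theorem mazurTateCongruence_of_facts_undepletedMax
    (hES : eichlerShimura_depletedOptimalQuotient_periodLattice_of_dvd)
    (hF : WeierstrassCurve.isIsogenous_iff_frobeniusTrace_eq) (hMK : mazurKenku_exists_cyclic_isogeny)
    (hSD : heckeSelfDual_torsionBy_J0) (hBz : buzzard2000_multiplicityOne_gamma0)
    (hSe : serre1972_supersingular_decompositionSubgroup_image)
    (h2 : realPeriodRat_eq_unit_mul_plusPeriod_two)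
    (hss : GoodSS W 2) (ha : W.frobeniusTrace 2 = 0) (hΔ : W.Δ < 0) (hssA : GoodSS A 2) (haA : A.frobeniusTrace 2 = 0)
    (he : ∃ e : geomTorsion W (2 : ℤ) ≃+ geomTorsion A (2 : ℤ),
      ∀ (σ : Field.absoluteGaloisGroup ℚ) (P : geomTorsion W (2 : ℤ)), e (σ • P) = σ • e P)
    [NeZero (W.conductorNorm ℤ)] (f : CuspForm (Gamma0 (W.conductorNorm ℤ)) 2) (hf : IsNewformOf W f) {ϖ : ℚ}
    (hϖ : (ϖ : ℝ) * W.realPeriodRat = plusPeriod f)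
    {Lplus Lminus : IwasawaAlgebra 2} (hPP : IsPollackPair f 2 Lplus Lminus)
    [NeZero (A.conductorNorm ℤ)] (fA : CuspForm (Gamma0 (A.conductorNorm ℤ)) 2) (hfA : IsNewformOf A fA) {ϖA : ℚ}
    (hϖA : (ϖA : ℝ) * A.realPeriodRat = plusPeriod fA)
    {LplusA LminusA : IwasawaAlgebra 2} (hPPA : IsPollackPair fA 2 LplusA LminusA)
    (S₀ : Finset (HeightOneSpectrum (𝓞 ℚ))) (hS2 : ∀ v ∈ S₀, ((2 : ℕ) : 𝓞 ℚ) ∉ v.asIdeal)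
    (hSW : ∀ v : HeightOneSpectrum (𝓞 ℚ), ¬ W.HasGoodReductionAt v → v ∈ S₀)
    (hSA : ∀ v : HeightOneSpectrum (𝓞 ℚ), ¬ A.HasGoodReductionAt v → v ∈ S₀)
    (hPRW : ∃ n₁ : ℕ, Even n₁ ∧ ∃ s : ZMod (2 ^ n₁), ∀ r : ℚ, ‖algebraMap ℚ (PadicAlgCl 2) (ratPlusSymbol f r)‖ ≤
      ‖algebraMap ℚ (PadicAlgCl 2) (ratPlusSymbol f ((((cyclotomicGenerator 2 : ZMod (2 ^ (n₁ + 2))) ^ s.val).val : ℚ) / (2 : ℚ) ^ (n₁ + 2)))‖)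
    (hPRA : ∃ n₁ : ℕ, Even n₁ ∧ ∃ s : ZMod (2 ^ n₁), ∀ r : ℚ, ‖algebraMap ℚ (PadicAlgCl 2) (ratPlusSymbol fA r)‖ ≤
      ‖algebraMap ℚ (PadicAlgCl 2) (ratPlusSymbol fA ((((cyclotomicGenerator 2 : ZMod (2 ^ (n₁ + 2))) ^ s.val).val : ℚ) / (2 : ℚ) ^ (n₁ + 2)))‖)
    {G GA : IwasawaAlgebra 2} {m m' : ℕ}
    (hG : iwasawaToPowerSeries 2 G =
      PowerSeries.C ((2 : ℚ_[2]) ^ m * (ϖ : ℚ_[2])) * iwasawaToPowerSeries 2 (kobayashiL 1 Lplus Lminus))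
    (hGA : iwasawaToPowerSeries 2 GA =
      PowerSeries.C ((2 : ℚ_[2]) ^ m' * (ϖA : ℚ_[2])) * iwasawaToPowerSeries 2 (kobayashiL 1 LplusA LminusA)) :
    ∃ u : ℤ_[2]ˣ, ∀ n : ℕ, Even n → ∃ q r : IwasawaAlgebra 2,
      PowerSeries.C (((2 : ℤ_[2]) ^ m' : ℤ_[2]) : ℚ_[2]) *
            (PowerSeries.C ((2 : ℚ_[2]) ^ m * (ϖ : ℚ_[2])) *
              ((mazurTateElement f 2 n).map (algebraMap ℚ ℚ_[2]) : PowerSeries ℚ_[2]) *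
              iwasawaToPowerSeries 2 (eulerFactorProductInv W 2 S₀)) -
          PowerSeries.C (((u : ℤ_[2]) * (2 : ℤ_[2]) ^ m : ℤ_[2]) : ℚ_[2]) *
            (PowerSeries.C ((2 : ℚ_[2]) ^ m' * (ϖA : ℚ_[2])) *
              ((mazurTateElement fA 2 n).map (algebraMap ℚ ℚ_[2]) : PowerSeries ℚ_[2]) *
              iwasawaToPowerSeries 2 (eulerFactorProductInv A 2 S₀)) =
        iwasawaToPowerSeries 2 (PowerSeries.C ((2 : ℤ_[2]) ^ (m + m' + 1)) * q + Sprung2017.toIwasawa 2 (cyclotomicOmega 2 n) * r) :=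
  mazurTateCongruence_of_facts W A hES hF hMK hSD hBz hSe hss hΔ hssA he f hf ϖ hPP fA hfA ϖA hPPA S₀ hS2 hSW hSA
    (symbolMu_of_undepletedMax W h2 hss ha hf hϖ S₀ hS2 hPRW) (symbolMu_of_undepletedMax A h2 hssA haA hfA hϖA S₀ hS2 hPRA) hG hGA

/-- **The crux's conclusion at `(W, A)` from PUB⁶ + the period fact + `CuspSpanEvenAtTwo` AT THE TWO CONDUCTORS `N_W`, `N_A`** (the
curve-free node of route ResidualThetaTransportAtTwo, open in general, a finite `𝔽₂`-linear-algebra statement per level; a theorem at some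
levels, e.g. `cuspSpanEvenAtTwo_twentyseven`, `cuspSpanEvenAtTwo_of_units_four_pow`). (PR₂) at each curve by
`undepletedMax_of_cuspSpanEvenAtTwo`. BSD is not proved by this. [cite: Pollack2003, Conj. 6.3] [cite: GreenbergVatsal2000, Thm. (1.4), §3 (13)] -/
theorem mazurTateCongruence_of_facts_cuspSpanAt
    (hES : eichlerShimura_depletedOptimalQuotient_periodLattice_of_dvd)
    (hF : WeierstrassCurve.isIsogenous_iff_frobeniusTrace_eq) (hMK : mazurKenku_exists_cyclic_isogeny)
    (hSD : heckeSelfDual_torsionBy_J0) (hBz : buzzard2000_multiplicityOne_gamma0)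
    (hSe : serre1972_supersingular_decompositionSubgroup_image)
    (h2 : realPeriodRat_eq_unit_mul_plusPeriod_two)
    (hss : GoodSS W 2) (ha : W.frobeniusTrace 2 = 0) (hΔ : W.Δ < 0) (hssA : GoodSS A 2) (haA : A.frobeniusTrace 2 = 0)
    (he : ∃ e : geomTorsion W (2 : ℤ) ≃+ geomTorsion A (2 : ℤ),
      ∀ (σ : Field.absoluteGaloisGroup ℚ) (P : geomTorsion W (2 : ℤ)), e (σ • P) = σ • e P)
    [NeZero (W.conductorNorm ℤ)] (f : CuspForm (Gamma0 (W.conductorNorm ℤ)) 2) (hf : IsNewformOf W f) {ϖ : ℚ}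
    (hϖ : (ϖ : ℝ) * W.realPeriodRat = plusPeriod f)
    {Lplus Lminus : IwasawaAlgebra 2} (hPP : IsPollackPair f 2 Lplus Lminus)
    [NeZero (A.conductorNorm ℤ)] (fA : CuspForm (Gamma0 (A.conductorNorm ℤ)) 2) (hfA : IsNewformOf A fA) {ϖA : ℚ}
    (hϖA : (ϖA : ℝ) * A.realPeriodRat = plusPeriod fA)
    {LplusA LminusA : IwasawaAlgebra 2} (hPPA : IsPollackPair fA 2 LplusA LminusA)
    (S₀ : Finset (HeightOneSpectrum (𝓞 ℚ))) (hS2 : ∀ v ∈ S₀, ((2 : ℕ) : 𝓞 ℚ) ∉ v.asIdeal)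
    (hSW : ∀ v : HeightOneSpectrum (𝓞 ℚ), ¬ W.HasGoodReductionAt v → v ∈ S₀)
    (hSA : ∀ v : HeightOneSpectrum (𝓞 ℚ), ¬ A.HasGoodReductionAt v → v ∈ S₀)
    (hGW : SignedMuAtTwo.CuspSpanEvenAtTwo (W.conductorNorm ℤ)) (hGAc : SignedMuAtTwo.CuspSpanEvenAtTwo (A.conductorNorm ℤ))
    {G GA : IwasawaAlgebra 2} {m m' : ℕ}
    (hG : iwasawaToPowerSeries 2 G =
      PowerSeries.C ((2 : ℚ_[2]) ^ m * (ϖ : ℚ_[2])) * iwasawaToPowerSeries 2 (kobayashiL 1 Lplus Lminus))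
    (hGA : iwasawaToPowerSeries 2 GA =
      PowerSeries.C ((2 : ℚ_[2]) ^ m' * (ϖA : ℚ_[2])) * iwasawaToPowerSeries 2 (kobayashiL 1 LplusA LminusA)) :
    ∃ u : ℤ_[2]ˣ, ∀ n : ℕ, Even n → ∃ q r : IwasawaAlgebra 2,
      PowerSeries.C (((2 : ℤ_[2]) ^ m' : ℤ_[2]) : ℚ_[2]) *
            (PowerSeries.C ((2 : ℚ_[2]) ^ m * (ϖ : ℚ_[2])) *
              ((mazurTateElement f 2 n).map (algebraMap ℚ ℚ_[2]) : PowerSeries ℚ_[2]) *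
              iwasawaToPowerSeries 2 (eulerFactorProductInv W 2 S₀)) -
          PowerSeries.C (((u : ℤ_[2]) * (2 : ℤ_[2]) ^ m : ℤ_[2]) : ℚ_[2]) *
            (PowerSeries.C ((2 : ℚ_[2]) ^ m' * (ϖA : ℚ_[2])) *
              ((mazurTateElement fA 2 n).map (algebraMap ℚ ℚ_[2]) : PowerSeries ℚ_[2]) *
              iwasawaToPowerSeries 2 (eulerFactorProductInv A 2 S₀)) =
        iwasawaToPowerSeries 2 (PowerSeries.C ((2 : ℤ_[2]) ^ (m + m' + 1)) * q + Sprung2017.toIwasawa 2 (cyclotomicOmega 2 n) * r) :=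
  mazurTateCongruence_of_facts_undepletedMax W A hES hF hMK hSD hBz hSe h2 hss ha hΔ hssA haA he f hf hϖ hPP fA hfA hϖA hPPA S₀ hS2
    hSW hSA (undepletedMax_of_cuspSpanEvenAtTwo hf hss ha hGW) (undepletedMax_of_cuspSpanEvenAtTwo hfA hssA haA hGAc) hG hGA

/-- **The crux's conclusion at `(W, A)` from PUB⁶ + the period fact + TWO UNIT L-VALUES — no conjecture-grade input.** If
`[0]⁺_f = L(f,1)/Ω⁺_f` and `[0]⁺_{f_A} = L(f_A,1)/Ω⁺_{f_A}` are `2`-adic units (Kurihara's unit-L-value case at both curves; by the period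
fact, `L(W,1)/Ω_W, L(A,1)/Ω_A ∈ ℤ₂ˣ`), then — granted the six plus-line facts and `realPeriodRat_eq_unit_mul_plusPeriod_two` — the oriented
`S₀`-depleted Mazur–Tate congruence holds at `(W, A)` at every even layer with `u = 1`, for every admissible `S₀`, every Pollack pair and
every integral multiple. A per-class certificate road for K1: the two unit L-values are finite numerical data. BSD is not proved by this.
[cite: Kurihara2002, Thm. 0.1 (unit L-value hypothesis; shape)] [cite: GreenbergVatsal2000, Thm. (1.4), §3 (13)] [cite: Vatsal1999, Thm. (1.13)] -/
theorem mazurTateCongruence_of_facts_unitLValues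
    (hES : eichlerShimura_depletedOptimalQuotient_periodLattice_of_dvd)
    (hF : WeierstrassCurve.isIsogenous_iff_frobeniusTrace_eq) (hMK : mazurKenku_exists_cyclic_isogeny)
    (hSD : heckeSelfDual_torsionBy_J0) (hBz : buzzard2000_multiplicityOne_gamma0)
    (hSe : serre1972_supersingular_decompositionSubgroup_image)
    (h2 : realPeriodRat_eq_unit_mul_plusPeriod_two)
    (hss : GoodSS W 2) (ha : W.frobeniusTrace 2 = 0) (hΔ : W.Δ < 0) (hssA : GoodSS A 2) (haA : A.frobeniusTrace 2 = 0)
    (he : ∃ e : geomTorsion W (2 : ℤ) ≃+ geomTorsion A (2 : ℤ),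
      ∀ (σ : Field.absoluteGaloisGroup ℚ) (P : geomTorsion W (2 : ℤ)), e (σ • P) = σ • e P)
    [NeZero (W.conductorNorm ℤ)] (f : CuspForm (Gamma0 (W.conductorNorm ℤ)) 2) (hf : IsNewformOf W f) {ϖ : ℚ}
    (hϖ : (ϖ : ℝ) * W.realPeriodRat = plusPeriod f)
    {Lplus Lminus : IwasawaAlgebra 2} (hPP : IsPollackPair f 2 Lplus Lminus)
    [NeZero (A.conductorNorm ℤ)] (fA : CuspForm (Gamma0 (A.conductorNorm ℤ)) 2) (hfA : IsNewformOf A fA) {ϖA : ℚ}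
    (hϖA : (ϖA : ℝ) * A.realPeriodRat = plusPeriod fA)
    {LplusA LminusA : IwasawaAlgebra 2} (hPPA : IsPollackPair fA 2 LplusA LminusA)
    (S₀ : Finset (HeightOneSpectrum (𝓞 ℚ))) (hS2 : ∀ v ∈ S₀, ((2 : ℕ) : 𝓞 ℚ) ∉ v.asIdeal)
    (hSW : ∀ v : HeightOneSpectrum (𝓞 ℚ), ¬ W.HasGoodReductionAt v → v ∈ S₀)
    (hSA : ∀ v : HeightOneSpectrum (𝓞 ℚ), ¬ A.HasGoodReductionAt v → v ∈ S₀)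
    (h0W : ‖algebraMap ℚ (PadicAlgCl 2) (ratPlusSymbol f 0)‖ = 1) (h0A : ‖algebraMap ℚ (PadicAlgCl 2) (ratPlusSymbol fA 0)‖ = 1)
    {G GA : IwasawaAlgebra 2} {m m' : ℕ}
    (hG : iwasawaToPowerSeries 2 G =
      PowerSeries.C ((2 : ℚ_[2]) ^ m * (ϖ : ℚ_[2])) * iwasawaToPowerSeries 2 (kobayashiL 1 Lplus Lminus))
    (hGA : iwasawaToPowerSeries 2 GA =
      PowerSeries.C ((2 : ℚ_[2]) ^ m' * (ϖA : ℚ_[2])) * iwasawaToPowerSeries 2 (kobayashiL 1 LplusA LminusA)) :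
    ∃ u : ℤ_[2]ˣ, ∀ n : ℕ, Even n → ∃ q r : IwasawaAlgebra 2,
      PowerSeries.C (((2 : ℤ_[2]) ^ m' : ℤ_[2]) : ℚ_[2]) *
            (PowerSeries.C ((2 : ℚ_[2]) ^ m * (ϖ : ℚ_[2])) *
              ((mazurTateElement f 2 n).map (algebraMap ℚ ℚ_[2]) : PowerSeries ℚ_[2]) *
              iwasawaToPowerSeries 2 (eulerFactorProductInv W 2 S₀)) -
          PowerSeries.C (((u : ℤ_[2]) * (2 : ℤ_[2]) ^ m : ℤ_[2]) : ℚ_[2]) *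
            (PowerSeries.C ((2 : ℚ_[2]) ^ m' * (ϖA : ℚ_[2])) *
              ((mazurTateElement fA 2 n).map (algebraMap ℚ ℚ_[2]) : PowerSeries ℚ_[2]) *
              iwasawaToPowerSeries 2 (eulerFactorProductInv A 2 S₀)) =
        iwasawaToPowerSeries 2 (PowerSeries.C ((2 : ℤ_[2]) ^ (m + m' + 1)) * q + Sprung2017.toIwasawa 2 (cyclotomicOmega 2 n) * r) :=
  mazurTateCongruence_of_facts_undepletedMax W A hES hF hMK hSD hBz hSe h2 hss ha hΔ hssA haA he f hf hϖ hPP fA hfA hϖA hPPA S₀ hS2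
    hSW hSA (undepletedMax_layerZero_of_norm_ratPlusSymbol_zero_eq_one hf hss ha h0W)
    (undepletedMax_layerZero_of_norm_ratPlusSymbol_zero_eq_one hfA hssA haA h0A) hG hGA

end Pair

/-! ## §3. THE CRUX BY NAME behind the seven named facts and the per-curve statement (PR₂) -/

section Crux

/-- **`MazurTateCongruenceAtTwoTop` (crux 25797 = 21416) BY NAME behind PUB⁶ + the period fact + «(PR₂) for every globally minimal curve
good supersingular at `2` with `a₂ = 0`»** — the per-curve `μ`-statement «the undepleted `2`-adic plus symbol of the newform is maximal over
`ℚ` at a `2`-power cusp of some even layer» for every such curve (Perrin-Riou–Pollack `μ = 0` at the supersingular prime `2`, even branch, one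
finite computation per curve; implied by `CuspSpanEvenAtTwo` at all odd levels, `undepletedMax_of_cuspSpanEvenAtTwo`). `HΔ` by `habitatNegDisc`.
BSD is not proved by this. [cite: PollackWeston2011MT, Rem. 4.2.1 (conjecture μ^± = 0)] [cite: GreenbergVatsal2000, Thm. (1.4), §3 (13)] -/
theorem mazurTateCongruenceAtTwoTop_of_facts_undepletedMax
    (hES : eichlerShimura_depletedOptimalQuotient_periodLattice_of_dvd)
    (hF : WeierstrassCurve.isIsogenous_iff_frobeniusTrace_eq) (hMK : mazurKenku_exists_cyclic_isogeny)
    (hSD : heckeSelfDual_torsionBy_J0) (hBz : buzzard2000_multiplicityOne_gamma0)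
    (hSe : serre1972_supersingular_decompositionSubgroup_image)
    (h2 : realPeriodRat_eq_unit_mul_plusPeriod_two)
    (hPR : ∀ (E : WeierstrassCurve ℚ) [E.IsElliptic] [E.IsGloballyMinimal], GoodSS E 2 → E.frobeniusTrace 2 = 0 →
      ∀ [NeZero (E.conductorNorm ℤ)] (f : CuspForm (Gamma0 (E.conductorNorm ℤ)) 2), IsNewformOf E f →
      ∃ n₁ : ℕ, Even n₁ ∧ ∃ s : ZMod (2 ^ n₁), ∀ r : ℚ, ‖algebraMap ℚ (PadicAlgCl 2) (ratPlusSymbol f r)‖ ≤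
        ‖algebraMap ℚ (PadicAlgCl 2) (ratPlusSymbol f ((((cyclotomicGenerator 2 : ZMod (2 ^ (n₁ + 2))) ^ s.val).val : ℚ) / (2 : ℚ) ^ (n₁ + 2)))‖) :
    Summit.BirchSwinnertonDyer.BirchSwinnertonDyer.Theses.ThetaPartnerAtTwo.MazurTateCongruenceAtTwoTop :=
  mazurTateCongruenceAtTwoTop_of_facts hES hF hMK hSD hBz hSe habitatNegDisc
    fun E _ _ hss ha _ f hf _ hϖ S₀ hS2 _ ↦ symbolMu_of_undepletedMax E h2 hss ha hf hϖ S₀ hS2 (hPR E hss ha f hf)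

/-- The twin `MazurTateCongruenceAtTwoR` (stmt-21416) BY NAME behind the same inputs. BSD is not proved by this.
[cite: GreenbergVatsal2000, Thm. (1.4), §3 (13)] -/
theorem mazurTateCongruenceAtTwoR_of_facts_undepletedMax
    (hES : eichlerShimura_depletedOptimalQuotient_periodLattice_of_dvd)
    (hF : WeierstrassCurve.isIsogenous_iff_frobeniusTrace_eq) (hMK : mazurKenku_exists_cyclic_isogeny)
    (hSD : heckeSelfDual_torsionBy_J0) (hBz : buzzard2000_multiplicityOne_gamma0)
    (hSe : serre1972_supersingular_decompositionSubgroup_image)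
    (h2 : realPeriodRat_eq_unit_mul_plusPeriod_two)
    (hPR : ∀ (E : WeierstrassCurve ℚ) [E.IsElliptic] [E.IsGloballyMinimal], GoodSS E 2 → E.frobeniusTrace 2 = 0 →
      ∀ [NeZero (E.conductorNorm ℤ)] (f : CuspForm (Gamma0 (E.conductorNorm ℤ)) 2), IsNewformOf E f →
      ∃ n₁ : ℕ, Even n₁ ∧ ∃ s : ZMod (2 ^ n₁), ∀ r : ℚ, ‖algebraMap ℚ (PadicAlgCl 2) (ratPlusSymbol f r)‖ ≤
        ‖algebraMap ℚ (PadicAlgCl 2) (ratPlusSymbol f ((((cyclotomicGenerator 2 : ZMod (2 ^ (n₁ + 2))) ^ s.val).val : ℚ) / (2 : ℚ) ^ (n₁ + 2)))‖) :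
    Summit.BirchSwinnertonDyer.BirchSwinnertonDyer.Theses.ThetaPartnerAtTwo.MazurTateCongruenceAtTwoR :=
  mazurTateCongruenceAtTwoTop_of_facts_undepletedMax hES hF hMK hSD hBz hSe h2 hPR

/-- **THE CRUX BY NAME behind {six plus-line facts, Abbes–Ullmo Thm. A} + «`∀ N` odd, `CuspSpanEvenAtTwo N`».** The period fact
`realPeriodRat_eq_unit_mul_plusPeriod_two` of `mazurTateCongruenceAtTwoTop_of_facts_cuspSpan` (`…RSymbolMuOfCuspSpan`) is itself a
COROLLARY over the tree of the lattice-form Manin-constant fact `abbesUllmo_not_dvd_maninConstant_of_not_dvd_level` (`2 ∤ c₀` for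
`2 ∤ N`; `SkinnerUrban2014.realPeriodRat_eq_unit_mul_plusPeriod_two_fact_of_abbesUllmo`: Edixhoven's `Λ(ω_{E₀}) = c₀Λ_f` and
Greenberg–Vatsal's Remark 3.4 at `p = 2` are proved there), so the SEVEN print inputs of K1 read: Eichler–Shimura (depleted optimal
quotient), Faltings, Mazur–Kenku, Hecke self-duality, Buzzard's mod-`2` multiplicity one, Serre 1972, Abbes–Ullmo Thm. A.
BSD is not proved by this. [cite: AbbesUllmo1996, Thm. A] [cite: GreenbergVatsal2000, Thm. (1.4), §3 (13) and Remark 3.4] -/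
theorem mazurTateCongruenceAtTwoTop_of_facts_abbesUllmo_cuspSpan
    (hES : eichlerShimura_depletedOptimalQuotient_periodLattice_of_dvd)
    (hF : WeierstrassCurve.isIsogenous_iff_frobeniusTrace_eq) (hMK : mazurKenku_exists_cyclic_isogeny)
    (hSD : heckeSelfDual_torsionBy_J0) (hBz : buzzard2000_multiplicityOne_gamma0)
    (hSe : serre1972_supersingular_decompositionSubgroup_image)
    (hAU : abbesUllmo_not_dvd_maninConstant_of_not_dvd_level)
    (hG : ∀ (N : ℕ) [NeZero N], ¬ 2 ∣ N → SignedMuAtTwo.CuspSpanEvenAtTwo N) :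
    Summit.BirchSwinnertonDyer.BirchSwinnertonDyer.Theses.ThetaPartnerAtTwo.MazurTateCongruenceAtTwoTop :=
  mazurTateCongruenceAtTwoTop_of_facts_cuspSpan hES hF hMK hSD hBz hSe
    (SkinnerUrban2014.realPeriodRat_eq_unit_mul_plusPeriod_two_fact_of_abbesUllmo hAU) hG

/-- The same with BOTH derived inputs derived: Hecke self-duality from the integral intersection-pairing fact
(`heckeSelfDual_torsionBy_J0_of_perfectPairing`) and the period unit from Abbes–Ullmo — the crux BY NAME behind {Eichler–Shimura
(depleted optimal quotient), Faltings, Mazur–Kenku, integral pairing, Buzzard, Serre 1972, Abbes–Ullmo} + «`∀ N` odd, `CuspSpanEvenAtTwo N`».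
BSD is not proved by this. [cite: AbbesUllmo1996, Thm. A] [cite: DarmonDiamondTaylor1995, §1.6 Lemma 1.38] [cite: GreenbergVatsal2000, Thm. (1.4), §3 (13)] -/
theorem mazurTateCongruenceAtTwoTop_of_facts_pairing_abbesUllmo_cuspSpan
    (hES : eichlerShimura_depletedOptimalQuotient_periodLattice_of_dvd)
    (hF : WeierstrassCurve.isIsogenous_iff_frobeniusTrace_eq) (hMK : mazurKenku_exists_cyclic_isogeny)
    (hpair : periodHomology_exists_heckeSelfAdjoint_perfectPairing) (hBz : buzzard2000_multiplicityOne_gamma0)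
    (hSe : serre1972_supersingular_decompositionSubgroup_image)
    (hAU : abbesUllmo_not_dvd_maninConstant_of_not_dvd_level)
    (hG : ∀ (N : ℕ) [NeZero N], ¬ 2 ∣ N → SignedMuAtTwo.CuspSpanEvenAtTwo N) :
    Summit.BirchSwinnertonDyer.BirchSwinnertonDyer.Theses.ThetaPartnerAtTwo.MazurTateCongruenceAtTwoTop :=
  mazurTateCongruenceAtTwoTop_of_facts_abbesUllmo_cuspSpan hES hF hMK (heckeSelfDual_torsionBy_J0_of_perfectPairing hpair) hBz hSe hAU hG

/-- The twin `MazurTateCongruenceAtTwoR` (stmt-21416) BY NAME behind {six plus-line facts, Abbes–Ullmo} + the node. BSD is not proved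
by this. [cite: AbbesUllmo1996, Thm. A] [cite: GreenbergVatsal2000, Thm. (1.4), §3 (13)] -/
theorem mazurTateCongruenceAtTwoR_of_facts_abbesUllmo_cuspSpan
    (hES : eichlerShimura_depletedOptimalQuotient_periodLattice_of_dvd)
    (hF : WeierstrassCurve.isIsogenous_iff_frobeniusTrace_eq) (hMK : mazurKenku_exists_cyclic_isogeny)
    (hSD : heckeSelfDual_torsionBy_J0) (hBz : buzzard2000_multiplicityOne_gamma0)
    (hSe : serre1972_supersingular_decompositionSubgroup_image)
    (hAU : abbesUllmo_not_dvd_maninConstant_of_not_dvd_level)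
    (hG : ∀ (N : ℕ) [NeZero N], ¬ 2 ∣ N → SignedMuAtTwo.CuspSpanEvenAtTwo N) :
    Summit.BirchSwinnertonDyer.BirchSwinnertonDyer.Theses.ThetaPartnerAtTwo.MazurTateCongruenceAtTwoR :=
  mazurTateCongruenceAtTwoTop_of_facts_abbesUllmo_cuspSpan hES hF hMK hSD hBz hSe hAU hG

end Crux

end Summit.BirchSwinnertonDyer.BirchSwinnertonDyer.Theorems.MazurTateCongruenceAtTwoR

end
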